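import Summits.SmoothPoincare4.SmoothPoincare4.Theorems.SullivanDualWitnessChargeDefs
import Mathlib.MeasureTheory.Integral.Lebesgue.Basic
import Mathlib.MeasureTheory.Constructions.BorelSpace.Complex

/-!
# Vocabulary of the line `crofton-pencil-laminar-charge` for crux `Target`
(item stmt-SmoothPoincare4-7823, route route-SmoothPoincare4-SullivanDual; skeleton v2
`Cruxes/Target/Lines/crofton_pencil_laminar_charge.lean`, lead a1)

Route-posited objects of the line, landed once here so that the files of the registered stubs
`stub_dualPlane` / `stub_linesOrCurve` can be stated over ONE tree definition each (as line
`pencil-incompleteness` did with `SullivanDualWitnessChargeDefs`):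

* `Yc σ p x` — the complex flat coordinates of the standard end in chart `σ : Bool`
  (`σ = false`: the tree's `Ycoord p x = (z, w)`; `σ = true`: the swapped pair `(w, z)`);
* `IsLine σ J u a b` — a `J`-LINE of chart `σ` with direction `a` and intercept `b`: a proper,
  injective, immersed, non-constant entire `J`-curve asymptotic in its canonical parametrisation to
  `w = a z + b` (resp. `z = a w + b`) — Gromov's `H`-spheres of `(Σ ∖ p) ∪ ℂP¹` minus their point at
  infinity, typed without the compactification; `isLine_false_zero_iff` links to the sibling
  vocabulary (`IsLine false J u 0 b ↔ IsPencilMember J u b`);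
* `lineEnergy ι u` — the energy `∫ ‖d(ι ∘ u)‖² ∈ [0, ∞]` of a parametrised curve in the metric of a
  map `ι : Σ → ℝᴺ`;
* `BoundedLines S p J` — "the dual plane of `J` is compact": for some smooth injective immersion
  `ι : Σ → ℝᴺ` the energies of all `J`-lines of both charts are uniformly bounded.

Registered helper proved here (so that the file serves the crux item): `helper_isLine_false_zero_iff`.
Deliberately NOT here: the stub statements and any claim about dual planes.
-/

noncomputable section

-- the prescribed namespace `Summit.<P>.<Sub>.…` duplicates `SmoothPoincare4` (P = Sub)
set_option linter.dupNamespace false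

open scoped Manifold ContDiff Topology ENNReal NNReal
open Set Filter MeasureTheory Literature.Geometry.Kaehler Literature.Geometry.Symplectic
  Literature.Topology.FourManifolds
open Summit.SmoothPoincare4.SmoothPoincare4.Theorems.WitnessCharge.PencilIncompleteness

namespace Summit.SmoothPoincare4.SmoothPoincare4.Theorems.Target.CroftonPencil

variable {S : HomotopySphere 4}

/-! ## Vocabulary -/


/-- Complex flat coordinates of the standard end in chart `σ`: for `σ = false` the tree's
`Ycoord p x = (z, w)`; for `σ = true` the SWAPPED pair `(w, z)` (a unitary change of the flat
coordinates, preserving `i` and `ω₀`). Lines of chart `false` are asymptotic to `w = a z + b`,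
lines of chart `true` to `z = a w + b`; together the two charts cover every line of
`X̄ = (Σ ∖ p) ∪ ℂP¹` other than the line at infinity. -/
def Yc (σ : Bool) (p : S.carrier) (x : punctured p) : ℂ × ℂ :=
  if σ then ((Ycoord p x).2, (Ycoord p x).1) else Ycoord p x

/-- A `J`-LINE of chart `σ` with direction `a` and intercept `b`: a non-constant `C^∞` entire
`J`-curve `u : ℂ → Σ ∖ p` which is injective, immersed, PROPER, and asymptotic at infinity, in its
canonical parametrisation, to the affine complex line of chart `σ` with data `(a, b)`:
`(Yc σ (u ξ)).1 − ξ → 0` and `(Yc σ (u ξ)).2 − a ξ → b` along `cocompact ℂ`. For `σ = false`,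
`a = 0` this is exactly the tree's `IsPencilMember J u b` (`isLine_false_zero_iff`). These are the
embedded `J̄`-spheres in the line class of `X̄ ≅ Σ # ℂP²` minus their point at infinity
(Gromov 1985 §2.4.A; McKay math/0101017 §6), written without compactifying the end. -/
def IsLine (σ : Bool) {p : S.carrier}
    (J : ∀ x : punctured p, TangentSpace (𝓡 4) x →L[ℝ] TangentSpace (𝓡 4) x)
    (u : ℂ → punctured p) (a b : ℂ) : Prop :=
  IsEntireJCurve (𝓡 4) J u ∧ Function.Injective u ∧
  (∀ ξ : ℂ, Function.Injective (mfderiv 𝓘(ℝ, ℂ) (𝓡 4) u ξ)) ∧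
  (∀ K : Set (punctured p), IsCompact K → IsCompact (u ⁻¹' K)) ∧
  Tendsto (fun ξ : ℂ => (Yc σ p (u ξ)).1 - ξ) (cocompact ℂ) (𝓝 0) ∧
  Tendsto (fun ξ : ℂ => (Yc σ p (u ξ)).2 - a * ξ) (cocompact ℂ) (𝓝 b)

/-- Link with the sibling line's vocabulary: the lines of chart `false` with direction `0` are
exactly the pencil members of line `pencil-incompleteness` (crux `WitnessCharge`). -/
theorem isLine_false_zero_iff {p : S.carrier}
    {J : ∀ x : punctured p, TangentSpace (𝓡 4) x →L[ℝ] TangentSpace (𝓡 4) x}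
    {u : ℂ → punctured p} {b : ℂ} : IsLine false J u 0 b ↔ IsPencilMember J u b := by
  simp only [IsLine, IsPencilMember, Yc, zero_mul, sub_zero, Bool.false_eq_true, ↓reduceIte]

/-- ENERGY of a parametrised curve `u : ℂ → Σ ∖ p` in the metric induced by a map
`ι : Σ → ℝᴺ` (an embedding in use): `∫ ‖d(ι ∘ u)‖² ∈ [0, ∞]` (lower Lebesgue integral of the
squared operator norm of the real derivative — no junk value). For a `J`-line in its canonical
parametrisation this is comparable, with constants depending only on `(Σ, ι, J)`, to the area of
its closure (a smooth sphere through `p`) in `Σ`, and it is finite. -/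
def lineEnergy {N : ℕ} (ι : S.carrier → EuclideanSpace ℝ (Fin N)) {p : S.carrier}
    (u : ℂ → punctured p) : ℝ≥0∞ :=
  ∫⁻ ξ : ℂ, ENNReal.ofReal (‖fderiv ℝ (fun ζ : ℂ => ι (u ζ).1) ξ‖ ^ 2)

/-- BOUNDED LINES ("the dual plane of `J` is compact"): for some smooth injective immersion
`ι : Σ → ℝᴺ` (all give comparable metrics, `Σ` being compact) the energies of ALL `J`-lines of
both charts are bounded by one constant. Holds for the standard structure of `S⁴ ∖ pt = ℂ²`
(lines are the affine lines; their closures are round `2`-spheres through the pole of area `≤ 4π`). -/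
def BoundedLines (S : HomotopySphere 4) (p : S.carrier)
    (J : ∀ x : punctured p, TangentSpace (𝓡 4) x →L[ℝ] TangentSpace (𝓡 4) x) : Prop :=
  ∃ (N : ℕ) (ι : S.carrier → EuclideanSpace ℝ (Fin N)),
    ContMDiff (𝓡 4) 𝓘(ℝ, EuclideanSpace ℝ (Fin N)) ∞ ι ∧ Function.Injective ι ∧
    (∀ x : S.carrier, Function.Injective (mfderiv (𝓡 4) 𝓘(ℝ, EuclideanSpace ℝ (Fin N)) ι x)) ∧
    ∃ A : ℝ≥0, ∀ (σ : Bool) (a b : ℂ) (u : ℂ → punctured p),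
      IsLine σ J u a b → lineEnergy ι u ≤ (A : ℝ≥0∞)


/-- **Registered helper `helper_isLine_false_zero_iff`**: the lines of chart `false` with
direction `0` are exactly the pencil members of line `pencil-incompleteness` (crux
`WitnessCharge`) — the link between the two vocabularies, for every `J`, `u`, `b`. -/
theorem helper_isLine_false_zero_iff :
    ∀ (S : HomotopySphere 4) (p : S.carrier)
      (J : ∀ x : punctured p, TangentSpace (𝓡 4) x →L[ℝ] TangentSpace (𝓡 4) x)
      (u : ℂ → punctured p) (b : ℂ), IsLine false J u 0 b ↔ IsPencilMember J u b := by
  intro S p J u b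
  exact isLine_false_zero_iff

end Summit.SmoothPoincare4.SmoothPoincare4.Theorems.Target.CroftonPencil

end
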